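import Literature.Algebra.Homology.GroupHomologyPermutationModule
import HarnessLib

/-!
# Stabilizer symbols generate `H₁(Γ, k[X])`: the explicit degree-one transfer (Brown III §9) applied to a
# permutation module

Topic `Literature/Algebra/Homology`; namespace `Literature.Algebra.Homology.PermutationCoeff`; sequel of
`GroupHomologyPermutationModule` (`permRep`, `permRepObj`, `stabilizerIn`, `stabSymbol`, `componentMap`).
Definitions with bodies and proved theorems; no named fact, no `sorry`, no instance, no notation.

## The argument (Brown III (6.3)–(6.5) and §9 (A)–(B), in degree one, on inhomogeneous chains)

Fix ORBIT DATA: `r : X → X` constant on `Γ`-orbits and `s : X → Γ` with `φ(s x) · r(x) = x`.  The **transfer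
element** `t(γ, x) = s(x)⁻¹ γ s(φ(γ)⁻¹x)` (`transferElt`) stabilizes `r(x)` (`transferElt_mem`) and satisfies the
cocycle identity `t(gh, x) = t(g, x) t(h, φ(g)⁻¹x)` (`transferElt_mul`).  From the two boundary relations
`[gh] ⊗ a ≡ [g] ⊗ a + [h] ⊗ g⁻¹a` (`single_add_single_sub_single_mul_mem_boundaries₁`) and
`[g⁻¹] ⊗ g⁻¹a + [g] ⊗ a ≡ 0` (Mathlib) one gets the **key congruence** (`single_single_congr`)

  `[γ] ⊗ aδ_x ≡ [t(γ, x)] ⊗ aδ_{r(x)} + (E(aδ_x) − E(φ(γ)⁻¹ aδ_x))   (mod B₁)`,  `E(aδ_y) := [s(y)] ⊗ aδ_y`,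

i.e. for every `1`-chain `c`: `c ≡ symbolPart c + Ē(Σ_γ c(γ)) − Ē(Σ_γ γ⁻¹c(γ))` (`chain_congr`, with the
`k`-linear maps `symbolPart`, `liftChain = Ē`, `coeffSum`, `twistedCoeffSum`).  For a CYCLE the two sums agree
(Mathlib `mem_cycles₁_iff`), so `c ≡ symbolPart c` (`sub_symbolPart_mem_boundaries₁`), `[c] = [symbolPart c]`
(`H1π_eq_H1π_symbolPart`), and `symbolPart c` is a `k`-combination of the stabilizer-symbol cycles
`t ⊗ aδ_{r(x)}` (`symbolPart_mem_chainSymbolSpan`).  Hence **`mem_symbolSpan_range`**: every class of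
`H₁(Γ, k[X])` lies in `symbolSpan k φ (range r)`, the span of the stabilizer symbols at the orbit points.
The choice-free corollaries (`symbolSpan_eq_top`, Shapiro) are in `GroupHomologyPermutationModuleShapiro`.

Implementation note: the few subtraction identities on the coerced Finsupp carrier are discharged by `abel`
(generic `sub_self` rewriting does not match its instance path).

## References
* K. S. Brown, *Cohomology of Groups*, GTM 87 (1982), Ch. II §3 (low-degree bar resolution), Ch. III §6
  Prop. 6.2, (6.3)–(6.5), §9 (A)–(B) (transfer on chains). [Brown1982]
-/

noncomputable section

open CategoryTheory groupHomology Finsupp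

universe u

namespace Literature.Algebra.Homology

namespace PermutationCoeff

variable {k : Type u} [CommRing k] {Γ S : Type u} [Group Γ] [Group S] (φ : Γ →* S)
  {X : Type u} [MulAction S X]

/-! ### Boundary relations in `C₁(Γ, A)` -/

section Boundaries

variable {A : Rep k Γ}

/-- The basic boundary relation `[gh] ⊗ a ≡ [g] ⊗ a + [h] ⊗ g⁻¹a`:
`single g a + single h (ρ(g⁻¹) a) - single (g * h) a ∈ B₁(Γ, A)`. [cite: Brown1982, Ch. II §3 (bar resolution in low degree)] -/
theorem single_add_single_sub_single_mul_mem_boundaries₁ (g h : Γ) (a : A) :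
    single g a + single h (A.ρ g⁻¹ a) - single (g * h) a ∈ boundaries₁ A := by
  refine ⟨single (g, h) a, ?_⟩
  rw [d₂₁_single]
  abel

end Boundaries

/-! ### Generation of `H₁(Γ, k[X])` by stabilizer symbols -/

section Generation

variable (r : X → X) (s : X → Γ)

/-- The **transfer element** `t(γ, x) = s(x)⁻¹ γ s(φ(γ)⁻¹ x)` attached to orbit data
(`r` = chosen point of the orbit, `s(x)` carries `r(x)` to `x`). [cite: Brown1982, Ch. III §9 (A) (transfer)] -/
def transferElt (γ : Γ) (x : X) : Γ := (s x)⁻¹ * γ * s (φ γ⁻¹ • x)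

/-- `s(x) · t(γ,x) · s(γ⁻¹x)⁻¹ = γ`. [cite: Brown1982, Ch. III §9 (A)] -/
theorem mul_transferElt_mul (γ : Γ) (x : X) :
    s x * (transferElt φ s γ x * (s (φ γ⁻¹ • x))⁻¹) = γ := by
  simp [transferElt, mul_assoc]

variable (hs : ∀ x, φ (s x) • r x = x) (hr : ∀ (γ : Γ) (x : X), r (φ γ • x) = r x)
include hs in
/-- `φ(s x)⁻¹ x = r(x)`. [cite: Brown1982, Ch. III §9 (A)] -/
theorem inv_smul_eq_r (x : X) : (φ (s x))⁻¹ • x = r x := by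
  rw [inv_smul_eq_iff, hs]

include hs hr in
/-- `t(γ, x)` stabilizes `r(x)`. [cite: Brown1982, Ch. III §9 (A)] -/
theorem transferElt_mem (γ : Γ) (x : X) : transferElt φ s γ x ∈ stabilizerIn φ (r x) := by
  rw [mem_stabilizerIn_iff, transferElt, map_mul, map_mul, mul_smul, mul_smul]
  have h1 : φ (s (φ γ⁻¹ • x)) • r x = φ γ⁻¹ • x := by
    conv_lhs => rw [← hr γ⁻¹ x]
    exact hs _
  rw [h1]
  simp only [map_inv, smul_inv_smul]
  exact inv_smul_eq_r φ r s hs x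

/-- The cocycle identity `t(gh, x) = t(g, x) · t(h, φ(g)⁻¹ x)`. [cite: Brown1982, Ch. III §9 (A)] -/
theorem transferElt_mul (g h : Γ) (x : X) :
    transferElt φ s (g * h) x = transferElt φ s g x * transferElt φ s h (φ g⁻¹ • x) := by
  simp only [transferElt, map_mul, mul_inv_rev, map_inv, mul_smul, mul_assoc, mul_inv_cancel_left]

include hs hr in
/-- **Key congruence.** Modulo boundaries,
`[γ] ⊗ aδ_x ≡ [t(γ,x)] ⊗ aδ_{r(x)} + ([s(x)] ⊗ aδ_x − [s(y)] ⊗ aδ_y)`, `y = φ(γ)⁻¹ x`. [cite: Brown1982, Ch. III §9 (A)–(B)] -/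
theorem single_single_congr (γ : Γ) (x : X) (a : k) :
    single γ (single x a) - single (transferElt φ s γ x) (single (r x) a)
      - (single (s x) (single x a) - single (s (φ γ⁻¹ • x)) (single (φ γ⁻¹ • x) a))
      ∈ boundaries₁ (permRepObj k φ X) := by
  set y := φ γ⁻¹ • x with hy
  set t := transferElt φ s γ x with ht
  set B := boundaries₁ (permRepObj k φ X)
  have hρ1 : (permRepObj k φ X).ρ (s x)⁻¹ (single x a) = single (r x) a := by
    show permRep k φ X (s x)⁻¹ (single x a) = _
    rw [permRep_single, map_inv, inv_smul_eq_r φ r s hs]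
  have hρ2 : (permRepObj k φ X).ρ t⁻¹ (single (r x) a) = single (r x) a := by
    show permRep k φ X t⁻¹ (single (r x) a) = _
    rw [permRep_single, inv_smul_eq_of_mem_stabilizerIn φ (transferElt_mem φ r s hs hr γ x)]
  have hρ3 : (permRepObj k φ X).ρ (s y)⁻¹ (single y a) = single (r x) a := by
    show permRep k φ X (s y)⁻¹ (single y a) = _
    rw [permRep_single, map_inv, inv_smul_eq_r φ r s hs, hy, hr]
  have Z1 := single_add_single_sub_single_mul_mem_boundaries₁ (A := permRepObj k φ X)
    (s x) (t * (s y)⁻¹) (single x a)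
  rw [hρ1, mul_transferElt_mul] at Z1
  have Z2 := single_add_single_sub_single_mul_mem_boundaries₁ (A := permRepObj k φ X)
    t (s y)⁻¹ (single (r x) a)
  rw [hρ2] at Z2
  have Z3 := single_inv_ρ_self_add_single_mem_boundaries₁ (A := permRepObj k φ X) (s y) (single y a)
  rw [hρ3] at Z3
  have := B.sub_mem Z3 (B.add_mem Z1 Z2)
  convert this using 1
  abel

/-- `Ē : k[X] → C₁(Γ, k[X])`, `aδ_x ↦ [s(x)] ⊗ aδ_x`. [folklore] -/
def liftChain : permRepObj k φ X →ₗ[k] (Γ →₀ permRepObj k φ X) :=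
  Finsupp.lsum k fun x => (lsingle (s x)).comp (lsingle (M := k) x)

/-- `Ē(aδ_x) = [s(x)] ⊗ aδ_x`. [cite: Brown1982, Ch. III §9 (A)] -/
@[simp] theorem liftChain_single (x : X) (a : k) :
    liftChain φ s (single x a) = single (s x) (single x a) := by
  simp [liftChain]

/-- The **symbol part** of a `1`-chain: `[γ] ⊗ aδ_x ↦ [t(γ, x)] ⊗ aδ_{r(x)}`. [cite: Brown1982, Ch. III §9 (A)] -/
def symbolPart : (Γ →₀ permRepObj k φ X) →ₗ[k] (Γ →₀ permRepObj k φ X) :=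
  Finsupp.lsum k fun γ => Finsupp.lsum k fun x =>
    (lsingle (transferElt φ s γ x)).comp (lsingle (M := k) (r x))

/-- `symbolPart([γ] ⊗ aδ_x) = [t(γ,x)] ⊗ aδ_{r(x)}`. [cite: Brown1982, Ch. III §9 (A)] -/
@[simp] theorem symbolPart_single_single (γ : Γ) (x : X) (a : k) :
    symbolPart φ r s (single γ (single x a)) = single (transferElt φ s γ x) (single (r x) a) := by
  simp [symbolPart]

/-- `c ↦ Σ_γ c(γ)` (sum of coefficients). [folklore] -/
def coeffSum : (Γ →₀ permRepObj k φ X) →ₗ[k] permRepObj k φ X := Finsupp.lsum k fun _ => LinearMap.id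

/-- `c ↦ Σ_γ γ⁻¹ · c(γ)`. [folklore] -/
def twistedCoeffSum : (Γ →₀ permRepObj k φ X) →ₗ[k] permRepObj k φ X :=
  Finsupp.lsum k fun γ => (permRepObj k φ X).ρ γ⁻¹

/-- `coeffSum c = Σ_γ c(γ)` as a `Finsupp.sum`. [cite: Brown1982, Ch. II §3] -/
theorem coeffSum_eq_sum (c : Γ →₀ permRepObj k φ X) :
    coeffSum φ c = c.sum fun _ f => f := by
  simp only [coeffSum, Finsupp.lsum_apply, LinearMap.id_coe]
  rfl

/-- `twistedCoeffSum c = Σ_γ γ⁻¹c(γ)` as a `Finsupp.sum` (the first sum in Mathlib's `mem_cycles₁_iff`). [cite: Brown1982, Ch. II §3] -/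
theorem twistedCoeffSum_eq_sum (c : Γ →₀ permRepObj k φ X) :
    twistedCoeffSum φ c = c.sum fun γ f => (permRepObj k φ X).ρ γ⁻¹ f := by
  simp [twistedCoeffSum]

/-- `coeffSum([γ] ⊗ f) = f`. [cite: Brown1982, Ch. II §3] -/
theorem coeffSum_single (γ : Γ) (f : permRepObj k φ X) : coeffSum φ (single γ f) = f := by
  simp [coeffSum]

/-- `twistedCoeffSum([γ] ⊗ f) = γ⁻¹f`. [cite: Brown1982, Ch. II §3] -/
theorem twistedCoeffSum_single (γ : Γ) (f : permRepObj k φ X) :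
    twistedCoeffSum φ (single γ f) = (permRepObj k φ X).ρ γ⁻¹ f := by
  simp [twistedCoeffSum]

include hs hr in
/-- The key congruence for an arbitrary `1`-chain `c`:
`c − symbolPart c − (Ē(Σ c) − Ē(Σ γ⁻¹c)) ∈ B₁`. [cite: Brown1982, Ch. III §9 (A)–(B)] -/
theorem chain_congr (c : Γ →₀ permRepObj k φ X) :
    c - symbolPart φ r s c - (liftChain φ s (coeffSum φ c) - liftChain φ s (twistedCoeffSum φ c))
      ∈ boundaries₁ (permRepObj k φ X) := by
  induction c using Finsupp.induction_linear with
  | zero =>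
    have e : (0 : Γ →₀ permRepObj k φ X) - symbolPart φ r s 0
        - (liftChain φ s (coeffSum φ 0) - liftChain φ s (twistedCoeffSum φ 0)) = 0 := by
      simp only [map_zero]; abel
    rw [e]; exact Submodule.zero_mem _
  | add c₁ c₂ h₁ h₂ =>
    have := (boundaries₁ (permRepObj k φ X)).add_mem h₁ h₂
    convert this using 1
    simp only [map_add]
    abel
  | single γ f =>
    induction f using Finsupp.induction_linear with
    | zero =>
      have e : (single γ (0 : permRepObj k φ X)) - symbolPart φ r s (single γ 0)
          - (liftChain φ s (coeffSum φ (single γ 0)) - liftChain φ s (twistedCoeffSum φ (single γ 0)))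
          = 0 := by
        simp only [single_zero, map_zero]; abel
      rw [e]; exact Submodule.zero_mem _
    | add f₁ f₂ h₁ h₂ =>
      have := (boundaries₁ (permRepObj k φ X)).add_mem h₁ h₂
      convert this using 1
      simp only [single_add, map_add]
      abel
    | single x a =>
      have := single_single_congr φ r s hs hr γ x a
      have hρ : (permRepObj k φ X).ρ γ⁻¹ (single x a) = single (φ γ⁻¹ • x) a := permRep_single φ _ _ _
      rw [symbolPart_single_single, coeffSum_single, twistedCoeffSum_single, hρ, liftChain_single,
        liftChain_single]
      exact this

include hs hr in
/-- For a `1`-CYCLE `c`: `c ≡ symbolPart c` modulo boundaries. [cite: Brown1982, Ch. III §9 (B)] -/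
theorem sub_symbolPart_mem_boundaries₁ (c : Γ →₀ permRepObj k φ X)
    (hc : c ∈ cycles₁ (permRepObj k φ X)) :
    c - symbolPart φ r s c ∈ boundaries₁ (permRepObj k φ X) := by
  have h := chain_congr φ r s hs hr c
  have hcyc : twistedCoeffSum φ c = coeffSum φ c := by
    rw [twistedCoeffSum_eq_sum, coeffSum_eq_sum]
    exact (mem_cycles₁_iff c).1 hc
  have e : c - symbolPart φ r s c - (liftChain φ s (coeffSum φ c) - liftChain φ s (twistedCoeffSum φ c))
      = c - symbolPart φ r s c := by
    rw [hcyc]; abel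
  rw [← e]
  exact h

include hs hr in
/-- The symbol part of a cycle is a cycle. [cite: Brown1982, Ch. III §9 (B)] -/
theorem symbolPart_mem_cycles₁ (c : Γ →₀ permRepObj k φ X) (hc : c ∈ cycles₁ (permRepObj k φ X)) :
    symbolPart φ r s c ∈ cycles₁ (permRepObj k φ X) := by
  have h1 := boundaries₁_le_cycles₁ _ (sub_symbolPart_mem_boundaries₁ φ r s hs hr c hc)
  have h2 := (cycles₁ (permRepObj k φ X)).sub_mem hc h1
  have e : c - (c - symbolPart φ r s c) = symbolPart φ r s c := by abel
  rw [e] at h2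
  exact h2

include hs hr in
/-- In `H₁(Γ, k[X])`: `[c] = [symbolPart c]`. [cite: Brown1982, Ch. III §9 (B)] -/
theorem H1π_eq_H1π_symbolPart (c : cycles₁ (permRepObj k φ X)) :
    H1π _ c = H1π _ ⟨symbolPart φ r s c.1, symbolPart_mem_cycles₁ φ r s hs hr c.1 c.2⟩ := by
  rw [H1π_eq_iff]
  exact sub_symbolPart_mem_boundaries₁ φ r s hs hr c.1 c.2

variable (k) in
/-- The span in `H₁(Γ, k[X])` of the stabilizer symbols `[γ ⊗ aδ_x]`, `x ∈ R`, `γ ∈ Γ_x`. [folklore] -/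
def symbolSpan (R : Set X) : Submodule k (H1 (permRepObj k φ X)) :=
  Submodule.span k {w | ∃ x ∈ R, ∃ (γ : stabilizerIn φ x) (a : k), w = stabSymbol k φ x γ a}

/-- A stabilizer symbol at a point of `R` lies in `symbolSpan R`. [cite: Brown1982, Ch. III §6 (6.5)] -/
theorem stabSymbol_mem_symbolSpan {R : Set X} {x : X} (hx : x ∈ R) (γ : stabilizerIn φ x) (a : k) :
    stabSymbol k φ x γ a ∈ symbolSpan k φ R :=
  Submodule.subset_span ⟨x, hx, γ, a, rfl⟩

/-- The chain-level span of the stabilizer-symbol cycles `γ ⊗ aδ_x`, `x ∈ R`, `γ ∈ Γ_x`. [folklore] -/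
def chainSymbolSpan (R : Set X) : Submodule k (Γ →₀ permRepObj k φ X) :=
  Submodule.span k {c | ∃ x ∈ R, ∃ γ ∈ stabilizerIn φ x, ∃ a : k, c = single γ (single x a)}

/-- Stabilizer-symbol chains are cycles. [cite: Brown1982, Ch. III §6 (6.3)] -/
theorem chainSymbolSpan_le_cycles₁ (R : Set X) :
    chainSymbolSpan φ R ≤ cycles₁ (permRepObj k φ X) :=
  Submodule.span_le.2 (by
    rintro _ ⟨x, -, γ, hγ, a, rfl⟩
    exact single_single_mem_cycles₁ k φ x hγ a)

include hs hr in
/-- The symbol part of any chain is a combination of stabilizer-symbol chains at the points `r(x)`. [cite: Brown1982, Ch. III §9 (A)] -/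
theorem symbolPart_mem_chainSymbolSpan (c : Γ →₀ permRepObj k φ X) :
    symbolPart φ r s c ∈ chainSymbolSpan φ (Set.range r) := by
  induction c using Finsupp.induction_linear with
  | zero => rw [map_zero]; exact Submodule.zero_mem _
  | add c₁ c₂ h₁ h₂ => rw [map_add]; exact Submodule.add_mem _ h₁ h₂
  | single γ f =>
    induction f using Finsupp.induction_linear with
    | zero => rw [single_zero, map_zero]; exact Submodule.zero_mem _
    | add f₁ f₂ h₁ h₂ => rw [single_add, map_add]; exact Submodule.add_mem _ h₁ h₂
    | single x a =>
      rw [symbolPart_single_single]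
      exact Submodule.subset_span ⟨r x, ⟨x, rfl⟩, _, transferElt_mem φ r s hs hr γ x, a, rfl⟩

/-- Classes of chains in `chainSymbolSpan R` lie in `symbolSpan R`. [cite: Brown1982, Ch. III §6 (6.5)] -/
theorem H1π_mem_symbolSpan_of_mem_chainSymbolSpan (R : Set X) (z : Γ →₀ permRepObj k φ X)
    (hz : z ∈ chainSymbolSpan φ R) :
    H1π _ ⟨z, chainSymbolSpan_le_cycles₁ φ R hz⟩ ∈ symbolSpan k φ R := by
  induction hz using Submodule.span_induction with
  | mem z hz =>
    obtain ⟨x, hx, γ, hγ, a, rfl⟩ := hz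
    exact stabSymbol_mem_symbolSpan φ hx ⟨γ, hγ⟩ a
  | zero =>
    have e : (⟨0, chainSymbolSpan_le_cycles₁ φ R (Submodule.zero_mem _)⟩ :
        cycles₁ (permRepObj k φ X)) = 0 := rfl
    rw [e, map_zero]; exact Submodule.zero_mem _
  | add y z hy hz ihy ihz =>
    have e : (⟨y + z, chainSymbolSpan_le_cycles₁ φ R (Submodule.add_mem _ hy hz)⟩ :
        cycles₁ (permRepObj k φ X)) =
        ⟨y, chainSymbolSpan_le_cycles₁ φ R hy⟩ + ⟨z, chainSymbolSpan_le_cycles₁ φ R hz⟩ := rfl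
    rw [e, map_add]; exact Submodule.add_mem _ ihy ihz
  | smul a y hy ih =>
    have e : (⟨a • y, chainSymbolSpan_le_cycles₁ φ R (Submodule.smul_mem _ a hy)⟩ :
        cycles₁ (permRepObj k φ X)) = a • ⟨y, chainSymbolSpan_le_cycles₁ φ R hy⟩ := rfl
    rw [e, map_smul]; exact Submodule.smul_mem _ a ih

include hs hr in
/-- **Generation (orbit-data form).** Every class of `H₁(Γ, k[X])` lies in the span of the stabilizer
symbols at the chosen orbit points `r(x)`. [cite: Brown1982, Ch. III §6 Prop. 6.2 with (6.3)–(6.5)] -/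
theorem mem_symbolSpan_range (z : H1 (permRepObj k φ X)) : z ∈ symbolSpan k φ (Set.range r) := by
  induction z using H1_induction_on with
  | h c =>
    rw [H1π_eq_H1π_symbolPart φ r s hs hr c]
    exact H1π_mem_symbolSpan_of_mem_chainSymbolSpan φ _ _
      (symbolPart_mem_chainSymbolSpan φ r s hs hr c.1)

end Generation

end PermutationCoeff

end Literature.Algebra.Homology
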